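import Literature.Computability.Complexity.MatchingDerivations
import HarnessLib

/-!
# BBCHPRRWZ Lemma 4.4 in support form: the partial-matching normal form of a polynomial

`MatchingDerivations.lean` proves Braun–Brown-Cohen–Huq–Pokutta–Raghavendra–Roy–Weitz–Zink,
*The matching problem has no small symmetric SDP*, Math. Program. 165 (2017), Lemma 4.4 in the form
"`F ≅_{deg F} F'` with `F'` in the span of the matching monomials `x_M`". This file rephrases it on
the level of SUPPORTS, which is the cell's typed statement `PartialMatchingNormalForm`
(HOME/pnp-psdrank-p2/Sketch-v2.lean §2c, verbatim, with its `IsPartialMatchingMonomial`):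
every exponent vector in the support of `F'` is multilinear with pairwise vertex-disjoint edges,
`deg F' ≤ deg F`, and `F - F'` is derivable from `𝒫_n` in degree `deg F`
(`partialMatchingNormalForm`). Tools: `xM M = monomial (𝟙_M) 1` (`Mod2.xM_eq_monomial`).

## References

* G. Braun et al., *The matching problem has no small symmetric SDP*, Math. Program. 165 (2017)
  643–662, Lemma 4.4 (arXiv:1504.00703, p. 8). [BraunEtAl2016]
-/

noncomputable section

open MvPolynomial Finset

namespace Literature.Computability.Complexity

variable {n : ℕ}

/-- The exponent vector of a matching monomial `x_M`: multilinear (all exponents `≤ 1`) with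
pairwise vertex-disjoint edges in its support. (The cell's `IsPartialMatchingMonomial`, verbatim.)
[cite: BraunEtAl2016, §4.3 (p. 8, "x_M := Π_{e ∈ M} x_e for a partial matching M")] -/
def IsPartialMatchingMonomial (mono : KnEdge n →₀ ℕ) : Prop :=
  (∀ e, mono e ≤ 1) ∧
    ∀ e₁ ∈ mono.support, ∀ e₂ ∈ mono.support, e₁ ≠ e₂ →
      ∀ v : Fin n, v ∈ (e₁ : Sym2 (Fin n)) → v ∉ (e₂ : Sym2 (Fin n))

namespace Mod2

/-- The indicator exponent vector `𝟙_M = Σ_{e ∈ M} e` of an edge set. [cite: BraunEtAl2016, §4.3 (p. 8)] -/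
def indic (M : Finset (KnEdge n)) : KnEdge n →₀ ℕ := ∑ e ∈ M, Finsupp.single e 1

/-- `𝟙_M(e) = [e ∈ M]`. [cite: BraunEtAl2016, §4.3 (p. 8)] -/
theorem indic_apply (M : Finset (KnEdge n)) (e : KnEdge n) : indic M e = if e ∈ M then 1 else 0 := by
  classical
  rw [indic, Finsupp.finsetSum_apply]
  simp_rw [Finsupp.single_apply]
  rw [Finset.sum_ite_eq']

/-- `supp 𝟙_M = M`. [cite: BraunEtAl2016, §4.3 (p. 8)] -/
theorem support_indic (M : Finset (KnEdge n)) : (indic M).support = M := by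
  ext e
  rw [Finsupp.mem_support_iff, indic_apply]
  split_ifs with h <;> simp [h]

/-- **`x_M = x^{𝟙_M}`**: the matching monomial is the monomial of the indicator exponent vector.
[cite: BraunEtAl2016, §4.3 (p. 8)] -/
theorem xM_eq_monomial (M : Finset (KnEdge n)) : xM M = monomial (indic M) 1 := by
  classical
  induction M using Finset.induction_on with
  | empty => simp [xM, indic]
  | insert e M he ih =>
    rw [xM_insert he, ih]
    unfold indic
    rw [sum_insert he, X, monomial_mul, one_mul]

/-- The indicator of a partial matching is a partial-matching monomial. [cite: BraunEtAl2016, §4.3 (p. 8)] -/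
theorem isPartialMatchingMonomial_indic {M : Finset (KnEdge n)} (hM : IsPartialMatching M) :
    IsPartialMatchingMonomial (indic M) := by
  refine ⟨fun e => by rw [indic_apply]; split_ifs <;> simp, fun e₁ h₁ e₂ h₂ hne v hv₁ hv₂ => ?_⟩
  rw [support_indic] at h₁ h₂
  exact hM e₁ h₁ e₂ h₂ hne v ⟨hv₁, hv₂⟩

end Mod2

/-- **BBCHPRRWZ Lemma 4.4, support form** (the cell's `PartialMatchingNormalForm`, verbatim): every
polynomial `F` in the edge variables of `K_n` has a normal form `F'` with `deg F' ≤ deg F`, all of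
whose monomials are partial-matching monomials, and `F - F'` derivable from `𝒫_n` in degree
`deg F`. [cite: BraunEtAl2016, Lemma 4.4 (p. 8)] -/
theorem partialMatchingNormalForm :
    ∀ n : ℕ, ∀ F : MvPolynomial (KnEdge n) ℝ, ∃ F' : MvPolynomial (KnEdge n) ℝ,
      F'.totalDegree ≤ F.totalDegree ∧ (∀ mono ∈ F'.support, IsPartialMatchingMonomial mono) ∧
        HasDerivationOfDegree (Mod2.system n) (F - F') F.totalDegree := by
  classical
  intro n F
  obtain ⟨F', hdeg, hcong, hspan⟩ := Mod2.exists_isCong_matchingCombination F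
  refine ⟨F', hdeg, ?_, ?_⟩
  · -- supports of elements of the span of the `x_M`
    refine Submodule.span_induction (p := fun G _ => ∀ mono ∈ G.support, IsPartialMatchingMonomial mono)
      ?_ ?_ ?_ ?_ hspan
    · rintro _ ⟨M, hM, rfl⟩ mono hmono
      rw [Mod2.xM_eq_monomial] at hmono
      have := support_monomial_subset hmono
      rw [mem_singleton] at this
      rw [this]
      exact Mod2.isPartialMatchingMonomial_indic hM
    · intro mono hmono
      simp at hmono
    · intro G H _ _ hG hH mono hmono
      rcases Finset.mem_union.1 (support_add hmono) with h | h
      · exact hG mono h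
      · exact hH mono h
    · intro a G _ hG mono hmono
      exact hG mono (support_smul hmono)
  · -- `F ≅ F'` means `F' - F` is derivable; flip the sign
    have h := (isCong_iff_hasDerivationOfDegree_sub.1 hcong.symm)
    exact h

end Literature.Computability.Complexity
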